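import Literature.IUT.HodgeArakelov.SubgraphReferenceGenuineIdentification
import Literature.IUT.HodgeArakelov.BadPlaceSettingOfUnderline
import HarnessLib

/-!
# [IUTchII] Prop 2.2 (i)′: the identification binders at the GENUINE environment of the Tate curve — the fully genuine closer
# and the NV witness («PROP22i-IDENT-GENUINE», part 2 of 2)

S. Mochizuki, *Inter-universal Teichmüller theory II*, kurims manuscript (Dec. 2020), §1 Prop. 1.2 (i) p. 25 («a functorial isomorphism
`Π ⥲ Π_X(M^Θ(Π))`»), §2 Prop. 2.1 p. 64, Prop. 2.2 (i) p. 66 l. 27–42; *Inter-universal Teichmüller theory I* (May 2020) §2 Cor. 2.3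
p. 47, Def. 3.1 (e) p. 62 [claim: Mochizuki2012, status: disputed] (D-0012 claim key; NOTHING of the series is asserted here); [EtTh] §1–§2
[cite: MochizukiEtTh2009, Def 2.5 (i) p.39]; [SemiAnbd] §6 [cite: MochizukiSemiAnbd2006, §6 pp.69-71].

abc-iut cell, layer L6, PROOF-ONLY companion (0 `def` / `instance` / `structure`; seat abc-iut-w6-d005 gen 3, by-name row «PROP22i-IDENT-GENUINE»,
abc-iut-L6-lead GO 2026-08-26T09:22:51Z), sequel of `SubgraphReferenceGenuineIdentification.lean` (p437538).  DAG node **IUTchII:Prop2.2(i)**;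
NV register row «`SubgraphReference` / Prop 2.2 (i) MERGE identification».  Part 1 DERIVED the binder `hker` of the (i)′ closers from the one
identification datum `hEnv : ∀ y, Env.recon.projG (Env.isoX y) = 1 ↔ D.aug y = 1` for an ABSTRACT environment `Env` (abc-iut-w5-d072
convention) and instantiated `C`, `j`, `e₀` at abc-iut-L5's [IUTchI] §2 datum of the genuine curve `X̲̲_v` (abc-iut-L6-t7's
`temperedCurveXuuOfLevelData`).  HERE `hEnv` itself is PROVED at the GENUINE environment: abc-iut-L6-d6's bridge B8 part 6
`ThetaSetting.envOfGroup` over abc-iut-L2-t8's REAL rigidity data `C.rigidData μ hC hS h15 L` of the Tate curve (ModelDef11Output),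
RE-BASED along its own `isoX` by `EnvOfGroup.transportAlong` (C110-S7) so that Prop. 1.2 (i)'s functorial isomorphism is the identity of
`Π_X(M^Θ(Π)) = Π^tp_X̲̲` (part 1 §3; the record's own `isoX := Nonempty.some _` is an unnamed choice).  This re-based environment IS an
`EnvOfGroup (BadPlaceSetting.ofUnderline …).toThetaSetting (Pi C)` — definitionally — so every theorem of part 1 applies to it.

WHAT IS PROVED.
* `EtaleThetaDataOfSetting.projG_isoX_genuineEnv_eq_one_iff` — **`hEnv` HOLDS** at the genuine re-based environment:
  `projG (isoX y) = 1 ↔ D.aug y = 1` (`Ker = Δ^tp_{X̲̲}`); proof = part 1 §3 + `rfl`.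
* **`prop22_i'_xuu_genuineEnv_of_outer`** — the FULLY GENUINE closer: at `S := BadPlaceSetting.ofUnderline` (abc-iut-L6-t19's print-faithful
  Prop. 2.1 model, `eS := refl`), the genuine environment and the genuine curve `X̲̲_v`, `Prop22_i' R T D' ι₀` for every `T`, `D'`, `ι₀`
  from `hG` (F-1782 `GroupTheoretic`, the printed proof's [SemiAnbd] Cor. 3.11 input), `hbullet` (the CHOICE `Π_{v•} := Π^tp_{X̲̲,ℍ}`,
  abc-iut-w5-d132's reading), `hOut` («`ℍ = Γ•_X` is `G_K`-stable», Rmk. 2.1.1 (ii)), the special-fibre DATA of `X̲̲_v`, and B8's own inputs —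
  of the five identification binders `C`, `j`, `e₀`, `hbullet`, `hker` of abc-iut-w5-d086's closers only the datum `hbullet` remains.
* **`SubgraphReference.exists_identification_genuine`** — the NV WITNESS: for any placement `Π_{v▶} := Q` between `Π^tp_{X̲̲,ℍ}` and
  `Π^tp_{Y̲_v}` (printed, p. 66 l. 38–42: `hQ`, `hQY`) there EXIST `R`, `C`, `j`, `e₀` with `R.refTri = Q`, `hbullet` AND `hker` at the
  genuine `S` / `Env` / `X̲̲_v` ⇒ NV row «NV-BLOCKED (p419232) → WITNESSED-GENUINE modulo the special-fibre data».

HONEST BINDER CENSUS (not discharged; all print-shaped DATA / the [EtTh] stack's standing named inputs, no `Prop` smuggled): the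
special-fibre data of `X̲̲_v` over the parameter bundle `d₀` of `X_v` (`Sf`, `h36`, `Σ ⊆ Σ̂`, `Π_ℍ := TpH` for `ℍ := Γ•_X`, `HatH`, `hle`,
`cuspMeetsH` — nobody constructs the dual graph of the special fibre of the [EtTh] model; abc-iut-L3's `SpecialFibreOrigin` lane); `hOut`;
`hbullet` resp. `hQ`/`hQY`; `hG` (F-1782); the §1–2 inputs `hC : D.Compat`, `hS : D.Sec2Hyps`, `hl`, `hp2`, `hpl`, `hζ`, a theta cocycle `hη`;
B8's `h15` = F-0591 `Prop15iii` BY NAME, cusp labels `L`, and `hZ` «`(l·Δ_Θ)(M) ≅ Ẑ`» (discharged of origin by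
`ModelCyclotomes.nonempty_lDeltaQuot_rigidData_mulEquiv_zHat`, not repeated here).  Typed ≠ proved for those; witnessed ≠ discharged;
no side is taken on [IUTchIII] Cor. 3.12; nothing here asserts that the printed reconstruction algorithms exist.
-/

noncomputable section

namespace Literature.IUT.HodgeArakelov

open Literature.AnabelianGeometry.EtaleTheta Literature.AnabelianGeometry.SemiGraphs Literature.IUT.HodgeTheaters
open EtaleThetaDataOfSetting
open scoped Pointwise

variable {p : ℕ} [Fact p.Prime] {D : Literature.AnabelianGeometry.EtaleTheta.ThetaSetting p}
  {E : D.EtaleThetaData} {l : ℕ} (C : E.DoubleUnderline l)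

/-! ### The identification datum `hEnv` at the GENUINE environment of the Tate curve; the fully genuine closer; the NV witness -/

section GenuineEnvTate

variable {N : ℕ+} (μ : D.CyclotomeMod l N) (hC : D.Compat) (hS : D.Sec2Hyps)
  (h15 : Literature.AnabelianGeometry.EtaleTheta.ThetaSetting.Prop15iii E hC) (L : C.CuspLabels)
  (hl : l.Prime) (hp2 : p ≠ 2) (hpl : p ≠ l) (hζ : ∃ ζ : D.K, IsPrimitiveRoot ζ (4 * l))
  {η : (C.thetaEnvData μ hC hS).PiYdd → MuN p N} (hη : η ∈ (C.thetaEnvData μ hC hS).thetaCocycles)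
  (hZ : Nonempty (ModelCyclotomes.lDeltaQuot (C.rigidData μ hC hS h15 L) ≃* Literature.IUT.HodgeTheaters.ZHat))

/-- **The identification datum `hEnv` HOLDS at the GENUINE environment of the Tate curve `X̲̲_K`**: for B8 part 6's `envOfGroup` over
abc-iut-L2-t8's REAL rigidity data `C.rigidData μ hC hS h15 L` (inputs: F-0591 `Prop15iii` BY NAME, cusp labels `L`, and `hZ`
«`(l·Δ_Θ)(M) ≅ Ẑ`» — discharged of origin by `ModelCyclotomes.nonempty_lDeltaQuot_rigidData_mulEquiv_zHat`), re-based to the identity by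
`EnvOfGroup.transportAlong`, `projG (isoX y) = 1 ↔ D.aug y = 1` for every `y ∈ Π_v = Π^tp_X̲̲`.  This re-based environment IS an
`EnvOfGroup (BadPlaceSetting.ofUnderline …).toThetaSetting (Pi C)` (definitionally), i.e. an admissible `Env` for every theorem of part 1.
[claim: Mochizuki2012, status: disputed] (IUTchII §1 Prop 1.2 (i), kurims p.25; §2 Prop 2.2 (i), kurims p.66) -/
theorem EtaleThetaDataOfSetting.projG_isoX_genuineEnv_eq_one_iff (y : Pi C) :
    ((ThetaSetting.envOfGroup (C.rigidData μ hC hS h15 L) (ThetaSetting.SideData.ofDoubleUnderline C μ hC hS hl hp2 hpl hζ hη)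
            (ThetaSetting.t1Space_Huu C) (ThetaSetting.isClosed_ker_aug_thetaEnvData C μ hC hS) hZ (Pi C)
            ⟨ContinuousMulEquiv.refl _⟩).transportAlong
          (ThetaSetting.envOfGroup (C.rigidData μ hC hS h15 L) (ThetaSetting.SideData.ofDoubleUnderline C μ hC hS hl hp2 hpl hζ hη)
            (ThetaSetting.t1Space_Huu C) (ThetaSetting.isClosed_ker_aug_thetaEnvData C μ hC hS) hZ (Pi C)
            ⟨ContinuousMulEquiv.refl _⟩).isoX).recon.projG
        (((ThetaSetting.envOfGroup (C.rigidData μ hC hS h15 L) (ThetaSetting.SideData.ofDoubleUnderline C μ hC hS hl hp2 hpl hζ hη)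
            (ThetaSetting.t1Space_Huu C) (ThetaSetting.isClosed_ker_aug_thetaEnvData C μ hC hS) hZ (Pi C)
            ⟨ContinuousMulEquiv.refl _⟩).transportAlong
          (ThetaSetting.envOfGroup (C.rigidData μ hC hS h15 L) (ThetaSetting.SideData.ofDoubleUnderline C μ hC hS hl hp2 hpl hζ hη)
            (ThetaSetting.t1Space_Huu C) (ThetaSetting.isClosed_ker_aug_thetaEnvData C μ hC hS) hZ (Pi C)
            ⟨ContinuousMulEquiv.refl _⟩).isoX).isoX y) = 1 ↔
      D.aug (y : D.PiTemp) = 1 := by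
  rw [ThetaSetting.projG_isoX_envOfGroup_transportAlong_eq_one_iff, ← OneMemClass.coe_eq_one]
  rfl

variable (d₀ : D.toTemperedCurve.GroupLevelData)
  (Sf : SpecialFibreData ((C.temperedCurveXuuOfLevelData C.l_ne_zero d₀).toTemperedArithmeticGroup
    (C.groupLevelDataXuu C.l_ne_zero d₀)))
  (h36 : Sf.Gc.Prop36Hypotheses) (Sigma SigmaHat : Set ℕ) (hsub : Sigma ⊆ SigmaHat) (hne : Sigma.Nonempty)
  (hprime : ∀ q ∈ SigmaHat, q.Prime) (hp : p ∉ Sigma) (TpH : Subgroup Sf.chart.G)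
  (HatH : Subgroup (TemperedGraphGroupData.exists_completion_of_prop36 Sf.Gc h36 Sf.chart).choose)
  (hle : TpH.map (TemperedGraphGroupData.exists_completion_of_prop36 Sf.Gc h36
    Sf.chart).choose_spec.choose.toMonoidHom ≤ HatH)
  (cuspMeetsH : {x : (C.temperedCurveXuuOfLevelData C.l_ne_zero d₀).Pt //
    (C.temperedCurveXuuOfLevelData C.l_ne_zero d₀).IsCusp x} → Prop)

/-- **IUTchII:Prop2.2(i)′ — the FULLY GENUINE closer**: at the bad-place setting `S := BadPlaceSetting.ofUnderline` of [IUTchII] Prop. 2.1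
(abc-iut-L6-d6/L6-t19, `eS := refl`), the GENUINE re-based B8 environment `Env` (so `hEnv` is the theorem
`projG_isoX_genuineEnv_eq_one_iff`), and abc-iut-L5's [IUTchI] §2 datum of the GENUINE curve `X̲̲_v` (`temperedCurveXuuOfLevelData`),
`Prop22_i' R T D' ι₀` holds for every Prop. 2.1 output `T`, Prop. 1.4 output `D'` and pointed inversion `ι₀` over `Env`, from `hG`
(F-1782), `hbullet` (the choice `Π_{v•} := Π^tp_{X̲̲,ℍ}`), `hOut` («`ℍ = Γ•_X` is `G_K`-stable», Rmk. 2.1.1 (ii)), the special-fibre DATA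
of `X̲̲_v`, and B8's own inputs (`h15` = F-0591, `L`, `hZ`).  Of the five identification binders of the (i)′ closers NONE is left:
`C`, `j := refl`, `e₀ := refl` are terms, `hker` and `hEnv` are theorems. [claim: Mochizuki2012, status: disputed] (IUTchII §2 Prop 2.2 (i), kurims pp.66-67; IUTchI §2 Cor 2.3, kurims p.47) -/
theorem prop22_i'_xuu_genuineEnv_of_outer
    (R : SubgraphReference (BadPlaceSetting.ofUnderline C μ hC hS hl hp2 hpl hζ hη))
    (T : TemperedCoverings (BadPlaceSetting.ofUnderline C μ hC hS hl hp2 hpl hζ hη) (Pi C))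
    (D' : EtaleThetaData (BadPlaceSetting.ofUnderline C μ hC hS hl hp2 hpl hζ hη).toThetaSetting (Pi C))
    (ι₀ : PointedInversion
      ((ThetaSetting.envOfGroup (C.rigidData μ hC hS h15 L) (ThetaSetting.SideData.ofDoubleUnderline C μ hC hS hl hp2 hpl hζ hη)
            (ThetaSetting.t1Space_Huu C) (ThetaSetting.isClosed_ker_aug_thetaEnvData C μ hC hS) hZ (Pi C)
            ⟨ContinuousMulEquiv.refl _⟩).transportAlong
        (ThetaSetting.envOfGroup (C.rigidData μ hC hS h15 L) (ThetaSetting.SideData.ofDoubleUnderline C μ hC hS hl hp2 hpl hζ hη)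
            (ThetaSetting.t1Space_Huu C) (ThetaSetting.isClosed_ker_aug_thetaEnvData C μ hC hS) hZ (Pi C)
            ⟨ContinuousMulEquiv.refl _⟩).isoX) D')
    (hG : R.GroupTheoretic)
    (hbullet : R.refBullet =
      (StableCurveTemperedData.ofSpecialFibre _ (C.groupLevelDataXuu C.l_ne_zero d₀) Sf h36 Sigma SigmaHat hsub hne
          hprime hp TpH HatH hle cuspMeetsH).piTpXH.map ((ContinuousMulEquiv.refl (Pi C)).trans
            (ContinuousMulEquiv.refl (Pi C))).toMulEquiv.toMonoidHom)
    (hOut : ∀ g : (StableCurveTemperedData.ofSpecialFibre _ (C.groupLevelDataXuu C.l_ne_zero d₀) Sf h36 Sigma SigmaHat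
          hsub hne hprime hp TpH HatH hle cuspMeetsH).PiTp,
      ∃ δ : (StableCurveTemperedData.ofSpecialFibre _ (C.groupLevelDataXuu C.l_ne_zero d₀) Sf h36 Sigma SigmaHat
          hsub hne hprime hp TpH HatH hle cuspMeetsH).DeltaTp,
        MulAut.conj g • ((StableCurveTemperedData.ofSpecialFibre _ (C.groupLevelDataXuu C.l_ne_zero d₀) Sf h36 Sigma
              SigmaHat hsub hne hprime hp TpH HatH hle cuspMeetsH).deltaTpH.map
            (StableCurveTemperedData.ofSpecialFibre _ (C.groupLevelDataXuu C.l_ne_zero d₀) Sf h36 Sigma SigmaHat hsub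
              hne hprime hp TpH HatH hle cuspMeetsH).DeltaTp.subtype) =
          MulAut.conj (δ : (StableCurveTemperedData.ofSpecialFibre _ (C.groupLevelDataXuu C.l_ne_zero d₀) Sf h36 Sigma
              SigmaHat hsub hne hprime hp TpH HatH hle cuspMeetsH).PiTp) •
            ((StableCurveTemperedData.ofSpecialFibre _ (C.groupLevelDataXuu C.l_ne_zero d₀) Sf h36 Sigma SigmaHat hsub
                hne hprime hp TpH HatH hle cuspMeetsH).deltaTpH.map
              (StableCurveTemperedData.ofSpecialFibre _ (C.groupLevelDataXuu C.l_ne_zero d₀) Sf h36 Sigma SigmaHat hsub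
                hne hprime hp TpH HatH hle cuspMeetsH).DeltaTp.subtype)) :
    Prop22_i' R T D' ι₀ :=
  prop22_i'_xuu_of_outer C _ (ContinuousMulEquiv.refl (Pi C)) _
    (EtaleThetaDataOfSetting.projG_isoX_genuineEnv_eq_one_iff C μ hC hS h15 L hl hp2 hpl hζ hη hZ) d₀ Sf h36 Sigma
    SigmaHat hsub hne hprime hp TpH HatH hle cuspMeetsH R T D' ι₀ hG hbullet hOut

/-- **NV WITNESS of the five identification binders** of the (i)′ closers at GENUINE data (NV register row «`SubgraphReference` /
Prop 2.2 (i) MERGE identification»: NV-BLOCKED ⟶ WITNESSED-GENUINE): at `S := ofUnderline`, the genuine re-based B8 environment and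
the genuine curve `X̲̲_v` with its [IUTchI] §2 datum, for any placement `Π_{v▶} := Q` between `Π^tp_{X̲̲,ℍ}` and `Π^tp_{Y̲_v}` (printed,
kurims p. 66 l. 38–42; binders `hQ`, `hQY`), there EXIST `R`, `C`, `j`, `e₀` with `R.refTri = Q`, `hbullet` AND `hker`.  Modulo: the
special-fibre DATA of `X̲̲_v` (`Sf`, `h36`, `Σ ⊆ Σ̂`, `Π_ℍ`, …), B8's inputs (`h15`, `L`, `hZ`), the standing [EtTh] §1–2 inputs
`hC`/`hS`/`hl`/`hp2`/`hpl`/`hζ`/`hη`.  Witnessed ≠ discharged. [claim: Mochizuki2012, status: disputed] (IUTchII §2 Prop 2.2 (i), kurims p.66) -/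
theorem SubgraphReference.exists_identification_genuine
    (Q : Subgroup (BadPlaceSetting.ofUnderline C μ hC hS hl hp2 hpl hζ hη).PiX)
    (hQ : (StableCurveTemperedData.ofSpecialFibre _ (C.groupLevelDataXuu C.l_ne_zero d₀) Sf h36 Sigma SigmaHat hsub hne
          hprime hp TpH HatH hle cuspMeetsH).piTpXH.map ((ContinuousMulEquiv.refl (Pi C)).trans
            (ContinuousMulEquiv.refl (Pi C))).toMulEquiv.toMonoidHom ≤ Q)
    (hQY : Q ≤ (BadPlaceSetting.ofUnderline C μ hC hS hl hp2 hpl hζ hη).refY.comap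
      (BadPlaceSetting.ofUnderline C μ hC hS hl hp2 hpl hζ hη).inclPlain) :
    ∃ (R : SubgraphReference (BadPlaceSetting.ofUnderline C μ hC hS hl hp2 hpl hζ hη))
      (Cst : StableCurveTemperedData.{0}) (j : Cst.PiTp ≃ₜ* (BadPlaceSetting.ofUnderline C μ hC hS hl hp2 hpl hζ hη).PiX)
      (e₀ : (Pi C) ≃ₜ* (BadPlaceSetting.ofUnderline C μ hC hS hl hp2 hpl hζ hη).PiX),
      R.refTri = Q ∧ R.refBullet = Cst.piTpXH.map j.toMulEquiv.toMonoidHom ∧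
        ∀ y : Pi C,
          ((ThetaSetting.envOfGroup (C.rigidData μ hC hS h15 L)
                    (ThetaSetting.SideData.ofDoubleUnderline C μ hC hS hl hp2 hpl hζ hη) (ThetaSetting.t1Space_Huu C)
                    (ThetaSetting.isClosed_ker_aug_thetaEnvData C μ hC hS) hZ (Pi C) ⟨ContinuousMulEquiv.refl _⟩).transportAlong
                (ThetaSetting.envOfGroup (C.rigidData μ hC hS h15 L)
                    (ThetaSetting.SideData.ofDoubleUnderline C μ hC hS hl hp2 hpl hζ hη) (ThetaSetting.t1Space_Huu C)
                    (ThetaSetting.isClosed_ker_aug_thetaEnvData C μ hC hS) hZ (Pi C) ⟨ContinuousMulEquiv.refl _⟩).isoX).recon.projG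
              (((ThetaSetting.envOfGroup (C.rigidData μ hC hS h15 L)
                    (ThetaSetting.SideData.ofDoubleUnderline C μ hC hS hl hp2 hpl hζ hη) (ThetaSetting.t1Space_Huu C)
                    (ThetaSetting.isClosed_ker_aug_thetaEnvData C μ hC hS) hZ (Pi C) ⟨ContinuousMulEquiv.refl _⟩).transportAlong
                (ThetaSetting.envOfGroup (C.rigidData μ hC hS h15 L)
                    (ThetaSetting.SideData.ofDoubleUnderline C μ hC hS hl hp2 hpl hζ hη) (ThetaSetting.t1Space_Huu C)
                    (ThetaSetting.isClosed_ker_aug_thetaEnvData C μ hC hS) hZ (Pi C) ⟨ContinuousMulEquiv.refl _⟩).isoX).isoX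
                y) = 1 ↔
            Cst.prTp (j.symm (e₀ y)) = 1 := by
  obtain ⟨R, hR, hb⟩ := SubgraphReference.exists_refTri_refBullet_eq C (BadPlaceSetting.ofUnderline C μ hC hS hl hp2 hpl hζ hη)
    (ContinuousMulEquiv.refl (Pi C)) (C.temperedCurveXuuOfLevelData C.l_ne_zero d₀) (ContinuousMulEquiv.refl (Pi C))
    (C.groupLevelDataXuu C.l_ne_zero d₀) Sf h36 Sigma SigmaHat hsub hne hprime hp TpH HatH hle cuspMeetsH Q hQ hQY
  refine ⟨R, StableCurveTemperedData.ofSpecialFibre _ (C.groupLevelDataXuu C.l_ne_zero d₀) Sf h36 Sigma SigmaHat hsub hne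
    hprime hp TpH HatH hle cuspMeetsH, (ContinuousMulEquiv.refl (Pi C)).trans (ContinuousMulEquiv.refl (Pi C)),
    ContinuousMulEquiv.refl (Pi C), hR, hb, fun y => ?_⟩
  exact projG_isoX_eq_one_iff_prTp_ofSpecialFibre C (BadPlaceSetting.ofUnderline C μ hC hS hl hp2 hpl hζ hη)
    (ContinuousMulEquiv.refl (Pi C)) _
    (EtaleThetaDataOfSetting.projG_isoX_genuineEnv_eq_one_iff C μ hC hS h15 L hl hp2 hpl hζ hη hZ)
    (C.temperedCurveXuuOfLevelData C.l_ne_zero d₀) (ContinuousMulEquiv.refl (Pi C)) (fun _ => rfl)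
    (C.groupLevelDataXuu C.l_ne_zero d₀) Sf h36 Sigma SigmaHat hsub hne hprime hp TpH HatH hle cuspMeetsH y

end GenuineEnvTate

end Literature.IUT.HodgeArakelov

end
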